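import Literature.NumberTheory.EllipticCurves.CasselsTateGeneralCase
import HarnessLib

/-!
# Inner invariance of the local terms of the general-case Cassels–Tate data

Route `SemiOrdinaryEisensteinDescent` (BSD, rung W-ALL row 2·3@3), Kolyvagin column, print item
`CasselsTateLevelInputsFact` (stmt-20191, conjunct 1 of `KolyvaginPrimitivesAtThree` 25896): towards the
conjunct (v) of `Literature.NumberTheory.EllipticCurves.casselsTate_levelInputs` (the `Aut(K/ℚ)`-invariance
of Milne's general-case value `ctGeneralFun`) for THE canonical invariant maps.

Milne's data `D` (*ADT* I, proof of Prop. 6.9, general case; the tree's `GeneralCaseData`) are GLOBAL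
continuous cochains `β, β₁, f, β', ε` of `Γ_K` plus, at each place `v`, a local Kummer cocycle `κ_v`; the
local term at `v` is `inv_v [z_v]`, `z_v = ι⁻¹(β_{1,v} - κ_v) ∪_desc β'_v - ε_v`, restrictions being taken
along the FIXED embedding `Γ_{K_v} → Γ_K`. An element `δ ∈ Γ_K` acts on the global cochains by the INNER
compatible pair: `(δ ⋆ C)(g₁, …, g_n) = δ · C(δ⁻¹ g₁ δ, …, δ⁻¹ g_n δ)`; restricting `δ ⋆ C` along the fixed
embedding is restricting `C` along a CONJUGATE embedding (another prime of `K̄` above `v`).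

* `locClass₂_cocycle_eq_of_innerShift` — the LOCAL computation: local data differing by the shifts
  `β₁ ↦ β₁ + ∂T₁ + ι γ`, `κ ↦ κ + ∂T₁`, `β' ↦ β' + ∂T'`, `ε ↦ ε + ∂ξ + γ ∪_desc β'_new + (f ∪₀ T')` have
  cohomologous local `2`-cocycles (`z' - z = -∂(σ ↦ desc(α σ, σ T') + ξ σ)`);
* `exists_innerTwist` — the data `δ ⋆ D` (same classes `b, b'`; `κ_v ↦ κ_v + ∂(β₁(δ))`) exist and
  **`δ ⋆ D` and `D` have the same local term at EVERY place**, via the chain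
  homotopy `h_δ C (g) = C(δ, δ⁻¹ g δ) - C(g, δ)`: `δ ⋆ C - C = ∂ h_δ C + h_δ ∂C` and
  `h_δ (f ∪ β') = h_δ f ∪ (δ ⋆ β') + f ∪₀ β'(δ)` give exactly the shifts above with `T₁ = β₁(δ)`,
  `T' = β'(δ)`, `γ = h_δ f`, `ξ = h_δ ε`.

This is the «independence of the prime of `K̄` above `v`» half of the functoriality of the Cassels–Tate
pairing under `Aut(K/ℚ)` (Gross 1991 §5 (5.1); McCallum 1991 §5); the semilinear transport is the sequel.
Nothing here is specific to a curve or a prime; BSD is not advanced.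

## References

* [MilneADT2006] J. S. Milne, *Arithmetic Duality Theorems*, 2nd ed. (2006), Ch. I §6, proof of Prop. 6.9.
* [SerreLocalFields1979] J.-P. Serre, *Local Fields* (1979), VII §5, Prop. 3 (inner automorphisms act
  trivially on cohomology; the explicit cochain homotopy).
* [GrossLMS1991] B. H. Gross, *Kolyvagin's work on modular elliptic curves* (1991), §5 (5.1).
-/

noncomputable section

open scoped Classical

-- the Theorems namespace of this sub repeats the summit name by design (D-0017 nested layout)
set_option linter.dupNamespace false
set_option autoImplicit false

universe u

namespace Summit.BirchSwinnertonDyer.BirchSwinnertonDyer.Theorems.CasselsTateConj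

open CategoryTheory _root_.WeierstrassCurve Field Function NumberField
open Literature.NumberTheory.EllipticCurves
open Literature.NumberTheory.GaloisRepresentations Literature.NumberTheory.GaloisCohomology
open Literature.NumberTheory.GaloisRepresentations.DiscreteGaloisModule (mu MuCarrier pairing)
open scoped ContRepresentation

/-! ## Inner conjugation: group identities and the twist of a `1`-cocycle -/

section Inner

variable {K : Type u} [Field K] (W : WeierstrassCurve K)

/-- `δ (δ⁻¹ g δ) = g δ`. [folklore] -/
private theorem mul_conj (δ g : absoluteGaloisGroup K) : δ * (δ⁻¹ * g * δ) = g * δ := by group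

/-- `(δ⁻¹ g δ)(δ⁻¹ h δ) = δ⁻¹ (g h) δ`. [folklore] -/
private theorem conj_mul_conj (δ g h : absoluteGaloisGroup K) :
    δ⁻¹ * g * δ * (δ⁻¹ * h * δ) = δ⁻¹ * (g * h) * δ := by group

/-- `g δ (δ⁻¹ h δ) = g h δ`. [folklore] -/
private theorem mul_delta_conj (δ g h : absoluteGaloisGroup K) : g * δ * (δ⁻¹ * h * δ) = g * h * δ := by group

/-- **The inner twist of a `1`-cocycle is the cocycle plus a coboundary**:
`δ • β(δ⁻¹ g δ) = β g + (g • β(δ) - β(δ))`. [cite: SerreLocalFields1979, VII §5 Prop. 3] -/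
theorem smul_oneCocycle_apply_conj (n : ℤ) (δ : absoluteGaloisGroup K)
    (β : contOneCocycles (W.torsionGaloisModule n).toTopRep) (g : absoluteGaloisGroup K) :
    δ • β.1 (δ⁻¹ * g * δ) = β.1 g + (g • β.1 δ - β.1 δ) := by
  rw [mul_assoc]
  change (W.torsionGaloisModule n).toTopRep.ρ δ (β.1 (δ⁻¹ * (g * δ))) = _
  rw [contOneCocycles.apply_smul_inv_mul, β.2 g δ]
  change β.1 g + g • β.1 δ - β.1 δ = _
  abel

/-- **The inner twist of a `2`-cocycle of `E[n]` is a `2`-cocycle** (`∂(δ ⋆ f) = δ ⋆ ∂f = 0`).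
[cite: SerreLocalFields1979, VII §5 Prop. 3] -/
theorem innerTwo_mem_contTwoCocycles (n : ℤ) (δ : absoluteGaloisGroup K)
    (f : contTwoCocycles (W.torsionGaloisModule n).toTopRep)
    (c : C(absoluteGaloisGroup K × absoluteGaloisGroup K, geomTorsion W n))
    (hc : ∀ g h, c (g, h) = δ • f.1 (δ⁻¹ * g * δ, δ⁻¹ * h * δ)) :
    c ∈ contTwoCocycles (W.torsionGaloisModule n).toTopRep :=
  (mem_contTwoCocycles_iff_dTwo _ _).2 fun σ τ υ => by
    have h := (mem_contTwoCocycles_iff_dTwo _ _).1 f.2 (δ⁻¹ * σ * δ) (δ⁻¹ * τ * δ) (δ⁻¹ * υ * δ)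
    rw [dTwo_apply] at h ⊢
    rw [hc, hc, hc, hc, ← conj_mul_conj, ← conj_mul_conj]
    change σ • δ • f.1 (δ⁻¹ * τ * δ, δ⁻¹ * υ * δ) - δ • f.1 (δ⁻¹ * σ * δ * (δ⁻¹ * τ * δ), δ⁻¹ * υ * δ) +
        δ • f.1 (δ⁻¹ * σ * δ, δ⁻¹ * τ * δ * (δ⁻¹ * υ * δ)) - δ • f.1 (δ⁻¹ * σ * δ, δ⁻¹ * τ * δ) = 0
    rw [← mul_smul, ← mul_conj δ σ, mul_smul]
    change δ • ((W.torsionGaloisModule n).toTopRep.ρ (δ⁻¹ * σ * δ) (f.1 (δ⁻¹ * τ * δ, δ⁻¹ * υ * δ))) -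
        δ • f.1 (δ⁻¹ * σ * δ * (δ⁻¹ * τ * δ), δ⁻¹ * υ * δ) +
        δ • f.1 (δ⁻¹ * σ * δ, δ⁻¹ * τ * δ * (δ⁻¹ * υ * δ)) - δ • f.1 (δ⁻¹ * σ * δ, δ⁻¹ * τ * δ) = 0
    rw [← smul_sub, ← smul_add, ← smul_sub, h, smul_zero]

end Inner

/-! ## The local computation: shifted local data have cohomologous cocycles -/

section LocalShift

variable {K : Type u} [Field K] [NumberField K] (W : WeierstrassCurve K) (m : ℕ) [NeZero m]
variable (E : Type u) [Field E] [Algebra K E]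
variable (e : geomTorsion W ((m * m : ℕ) : ℤ) → geomTorsion W ((m * m : ℕ) : ℤ) → AlgebraicClosure K)
  (hμ : ∀ S T, e S T ^ (m * m) = 1)
  (hadd₁ : ∀ S₁ S₂ T, e (S₁ + S₂) T = e S₁ T * e S₂ T)
  (hadd₂ : ∀ S T₁ T₂, e S (T₁ + T₂) = e S T₁ * e S T₂)
  (hgal : ∀ (σ : absoluteGaloisGroup K) (S T : geomTorsion W ((m * m : ℕ) : ℤ)),
    σ • e S T = e (σ • S) (σ • T))

variable {W m E e hμ hadd₁ hadd₂ hgal}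

/-- **Shifted local data have cohomologous local cocycles.** If two local data `L`, `L'` of the general case
over the `K`-field `E` differ by the shifts (`r : Γ_E → Γ_K` the fixed embedding, `∂` the coboundary)

* `β'₁ = β₁ + ∂T₁ + ι ∘ γ`, `κ' = κ + ∂T₁` (`T₁ ∈ E[m²]`, `γ` a `1`-cochain of `E[m]`),
* `β'' = β' + ∂T'` (`T' ∈ E[m]`),
* `ε' = ε + ∂ξ + γ ∪_desc β'' + η`, `η(σ, τ) = desc(f(σ, τ), στ T')` (`ξ` a `1`-cochain of `μ_{m²}`),

then `[z'] = [z]` in `H²(Γ_E, μ_{m²})`: indeed `α' = α + γ` and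
`z' - z = -∂(σ ↦ desc(α σ, σ T') + ξ σ)`. (The tree's `locClass₂_cocycle_eq_of_cobd` is `γ = 0`, `ξ = 0`,
`T₁ = 0`; `cocycle_eq_of_add_incl` is `T₁ = T' = 0`, `ξ = 0`.) [cite: MilneADT2006, Ch. I §6, proof of Prop. 6.9]
[cite: SerreLocalFields1979, VII §5 Prop. 3] -/
theorem locClass₂_cocycle_eq_of_innerShift {L L' : GeneralLocalData W m E e hμ hadd₁ hadd₂ hgal}
    (T₁ : geomTorsion W ((m * m : ℕ) : ℤ)) (T' : geomTorsion W (m : ℤ))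
    (γ : C(absoluteGaloisGroup E, torsionRepAt W E (m : ℤ)))
    (ξ : C(absoluteGaloisGroup E, muRepAt (K := K) m E))
    (hβ₁ : ∀ σ, L'.β₁ σ = L.β₁ σ + (absGaloisRestrict K E σ • T₁ - T₁) + inclKD W m m (γ σ))
    (hκ : ∀ σ, L'.κ.1 σ = L.κ.1 σ + (absGaloisRestrict K E σ • T₁ - T₁))
    (hβ' : ∀ σ, L'.β'.1 σ = L.β'.1 σ + (absGaloisRestrict K E σ • T' - T'))
    (hε : ∀ σ τ, L'.ε (σ, τ) = L.ε (σ, τ) +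
        ((muRepAt (K := K) m E).ρ σ (ξ τ) - ξ (σ * τ) + ξ σ) +
        descendHom W m m e hμ hadd₁ hadd₂ (γ σ) (L'.β'.1 (σ * τ) - L'.β'.1 σ) +
        descendHom W m m e hμ hadd₁ hadd₂ (L.f.1 (σ, τ)) (absGaloisRestrict K E (σ * τ) • T')) :
    locClass₂ _ E L'.cocycle = locClass₂ _ E L.cocycle := by
  haveI : CompactSpace (absoluteGaloisGroup E) := absoluteGaloisGroup_compactSpace E
  rw [← sub_eq_zero, ← locClass₂_sub]
  have hcont : Continuous fun σ : absoluteGaloisGroup E =>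
      -descendHom W m m e hμ hadd₁ hadd₂ (L.alpha σ) (absGaloisRestrict K E σ • T') - ξ σ :=
    ((((descendPairing W m m e hμ hadd₁ hadd₂ hgal).restrict (absGaloisRestrict K E)).continuous_toLin_comp
      L.alpha.continuous ((W.torsionGaloisModule (m : ℤ)).continuous_apply₂.comp
        ((map_continuous (absGaloisRestrict K E)).prodMk continuous_const))).neg).sub ξ.continuous
  refine (twoCocycleClass_eq_zero_iff _ (L'.cocycle - L.cocycle)).2 ⟨⟨_, hcont⟩, fun σ τ => ?_⟩
  change L'.cocycle.1 (σ, τ) - L.cocycle.1 (σ, τ) =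
    mu K (m * m) (absGaloisRestrict K E σ)
        (-descendHom W m m e hμ hadd₁ hadd₂ (L.alpha τ) (absGaloisRestrict K E τ • T') - ξ τ) -
      (-descendHom W m m e hμ hadd₁ hadd₂ (L.alpha (σ * τ)) (absGaloisRestrict K E (σ * τ) • T') - ξ (σ * τ)) +
      (-descendHom W m m e hμ hadd₁ hadd₂ (L.alpha σ) (absGaloisRestrict K E σ • T') - ξ σ)
  have hα : ∀ ν, L'.alpha ν = L.alpha ν + γ ν := fun ν => by
    rw [KummerLocalData.alpha_apply, KummerLocalData.alpha_apply]
    change levelDown W m (L'.β₁ ν - L'.κ.1 ν) = levelDown W m (L.β₁ ν - L.κ.1 ν) + γ ν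
    have hsplit : L'.β₁ ν - L'.κ.1 ν = (L.β₁ ν - L.κ.1 ν) + inclKD W m m (γ ν) := by
      rw [hβ₁, hκ]; abel
    rw [hsplit, levelDown_add W m (L.mulK_sub ν) (mulK_inclKD W m (γ ν)), levelDown_inclKD]
  have hξ : mu K (m * m) (absGaloisRestrict K E σ) (ξ τ) = (muRepAt (K := K) m E).ρ σ (ξ τ) := rfl
  rw [map_sub, map_neg, ← descendHom_smul W m m e hμ hadd₁ hadd₂ hgal, ← mul_smul, ← map_mul, hξ,
    GeneralLocalData.cocycle_apply_alpha, GeneralLocalData.cocycle_apply_alpha, hα, hε]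
  simp only [hβ']
  rw [L.f_eq_dOne_alpha σ τ, torsionRepAt_ρ_apply]
  simp only [map_add, map_sub, AddMonoidHom.add_apply, AddMonoidHom.sub_apply]
  abel

end LocalShift

/-! ## The inner twist of the global data and the invariance of the local terms -/

section Twist

variable {K : Type u} [Field K] [NumberField K] (W : WeierstrassCurve K) (m : ℕ) [NeZero m]
variable (e : geomTorsion W ((m * m : ℕ) : ℤ) → geomTorsion W ((m * m : ℕ) : ℤ) → AlgebraicClosure K)
  (hμ : ∀ S T, e S T ^ (m * m) = 1)
  (hadd₁ : ∀ S₁ S₂ T, e (S₁ + S₂) T = e S₁ T * e S₂ T)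
  (hadd₂ : ∀ S T₁ T₂, e S (T₁ + T₂) = e S T₁ * e S T₂)
  (hgal : ∀ (σ : absoluteGaloisGroup K) (S T : geomTorsion W ((m * m : ℕ) : ℤ)),
    σ • e S T = e (σ • S) (σ • T))

variable {W m e hμ hadd₁ hadd₂ hgal}

/-- **The inner twist `δ ⋆ D` of Milne's general-case data exists and has the same local terms.** For
`δ ∈ Γ_K` there are data `D'` for the SAME classes `b, b'` whose GLOBAL cochains are the inner twists
`(g₁, …) ↦ δ · C(δ⁻¹ g₁ δ, …)` of those of `D` (`C ∈ {β, β₁, f, β', ε}`), whose local Kummer cocycles are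
`κ_v + ∂(β₁(δ))`, and whose local term at EVERY place `v`, for every family `inv` of local invariant maps,
equals that of `D`. The restricted cochains of `D'` at `v` are obtained from those of `D` by the shifts of
`locClass₂_cocycle_eq_of_innerShift` with `T₁ = β₁(δ)`, `T' = β'(δ)`, `γ = (h_δ f)_v`, `ξ = (h_δ ε)_v`,
`h_δ C(g) = C(δ, δ⁻¹ g δ) - C(g, δ)`: the chain homotopy `δ ⋆ C - C = ∂ h_δ C + h_δ ∂C`, `∂ε = f ∪_desc β'`,
and the Leibniz rule `h_δ(f ∪ β') = h_δ f ∪ (δ ⋆ β') + (σ, τ) ↦ desc(f(σ,τ), στ β'(δ))`. So the local term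
of Milne's recipe at `v` does not depend on the prime of `K̄` above `v` along which the global cochains are
restricted. [cite: MilneADT2006, Ch. I §6, proof of Prop. 6.9] [cite: SerreLocalFields1979, VII §5 Prop. 3] -/
theorem exists_innerTwist (D : GeneralCaseData W m e hμ hadd₁ hadd₂ hgal) (δ : absoluteGaloisGroup K) :
    ∃ D' : GeneralCaseData W m e hμ hadd₁ hadd₂ hgal,
      D'.b = D.b ∧ D'.b' = D.b' ∧
      (∀ g, D'.β.1 g = δ • D.β.1 (δ⁻¹ * g * δ)) ∧
      (∀ g, D'.β₁ g = δ • D.β₁ (δ⁻¹ * g * δ)) ∧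
      (∀ g h, D'.f.1 (g, h) = δ • D.f.1 (δ⁻¹ * g * δ, δ⁻¹ * h * δ)) ∧
      (∀ g, D'.β'.1 g = δ • D.β'.1 (δ⁻¹ * g * δ)) ∧
      (∀ g h, D'.ε (g, h) = mu K (m * m) δ (D.ε (δ⁻¹ * g * δ, δ⁻¹ * h * δ))) ∧
      (∀ (v : Place K) (σ : absoluteGaloisGroup (Place.Completion v)),
        (D'.κ v).1 σ = (D.κ v).1 σ + (absGaloisRestrict K (Place.Completion v) σ • D.β₁ δ - D.β₁ δ)) ∧
      ∀ (inv : LocalInvariants K (m * m)) (v : Place K), D'.localTerm inv v = D.localTerm inv v := by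
  -- the twisted global cochains
  let β₁' : C(absoluteGaloisGroup K, geomTorsion W ((m * m : ℕ) : ℤ)) :=
    ⟨fun g => δ • D.β₁ (δ⁻¹ * g * δ),
      (W.torsionGaloisModule _).continuous_apply₂.comp (continuous_const.prodMk
        (D.β₁.continuous.comp ((continuous_const.mul continuous_id).mul continuous_const)))⟩
  let fc : C(absoluteGaloisGroup K × absoluteGaloisGroup K, geomTorsion W (m : ℤ)) :=
    ⟨fun p => δ • D.f.1 (δ⁻¹ * p.1 * δ, δ⁻¹ * p.2 * δ),
      (W.torsionGaloisModule _).continuous_apply₂.comp (continuous_const.prodMk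
        (D.f.1.continuous.comp (((continuous_const.mul continuous_fst).mul continuous_const).prodMk
          ((continuous_const.mul continuous_snd).mul continuous_const))))⟩
  let f' : contTwoCocycles (W.torsionGaloisModule (m : ℤ)).toTopRep :=
    ⟨fc, innerTwo_mem_contTwoCocycles W (m : ℤ) δ D.f fc fun g h => rfl⟩
  let ε' : C(absoluteGaloisGroup K × absoluteGaloisGroup K, MuCarrier K (m * m)) :=
    ⟨fun p => mu K (m * m) δ (D.ε (δ⁻¹ * p.1 * δ, δ⁻¹ * p.2 * δ)),
      (mu K (m * m)).continuous_apply₂.comp (continuous_const.prodMk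
        (D.ε.continuous.comp (((continuous_const.mul continuous_fst).mul continuous_const).prodMk
          ((continuous_const.mul continuous_snd).mul continuous_const))))⟩
  have hβc : ∀ g, (D.β + cobdCocycle W _ (D.β.1 δ)).1 g = δ • D.β.1 (δ⁻¹ * g * δ) := fun g =>
    (smul_oneCocycle_apply_conj W _ δ D.β g).symm
  have hβ'c : ∀ g, (D.β' + cobdCocycle W _ (D.β'.1 δ)).1 g = δ • D.β'.1 (δ⁻¹ * g * δ) := fun g =>
    (smul_oneCocycle_apply_conj W _ δ D.β' g).symm
  let D' : GeneralCaseData W m e hμ hadd₁ hadd₂ hgal :=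
    { b := D.b
      b_mem := D.b_mem
      β := D.β + cobdCocycle W _ (D.β.1 δ)
      hβ := by
        rw [oneCocycleClass_add, (oneCocycleClass_eq_zero_iff _ (cobdCocycle W _ (D.β.1 δ))).2
          ⟨D.β.1 δ, fun σ => rfl⟩, add_zero, D.hβ]
      β₁ := β₁'
      mulK_β₁ := fun σ => by
        rw [hβc]
        change mulK W m m (δ • D.β₁ (δ⁻¹ * σ * δ)) = _
        rw [mulK_smul, D.mulK_β₁]
      f := f'
      inclKD_f := fun σ τ => by
        change inclKD W m m (δ • D.f.1 (δ⁻¹ * σ * δ, δ⁻¹ * τ * δ)) =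
          σ • δ • D.β₁ (δ⁻¹ * τ * δ) - δ • D.β₁ (δ⁻¹ * (σ * τ) * δ) + δ • D.β₁ (δ⁻¹ * σ * δ)
        rw [inclKD_smul, D.inclKD_f, ← conj_mul_conj, smul_add, smul_sub, ← mul_smul δ (δ⁻¹ * σ * δ),
          mul_conj, mul_smul]
      b' := D.b'
      b'_mem := D.b'_mem
      β' := D.β' + cobdCocycle W _ (D.β'.1 δ)
      hβ' := by
        rw [oneCocycleClass_add, (oneCocycleClass_eq_zero_iff _ (cobdCocycle W _ (D.β'.1 δ))).2
          ⟨D.β'.1 δ, fun σ => rfl⟩, add_zero, D.hβ']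
      ε := ε'
      dTwo_ε := fun σ τ υ => by
        have h := D.dTwo_ε (δ⁻¹ * σ * δ) (δ⁻¹ * τ * δ) (δ⁻¹ * υ * δ)
        rw [ContPairing.cupCocycle₂₁_apply, dTwo_apply, descendPairing_toLin_apply] at h
        simp only [conj_mul_conj] at h
        rw [ContPairing.cupCocycle₂₁_apply, dTwo_apply, descendPairing_toLin_apply, hβ'c, hβ'c]
        change descendHom W m m e hμ hadd₁ hadd₂ (δ • D.f.1 (δ⁻¹ * σ * δ, δ⁻¹ * τ * δ)) _ =
          (mu K (m * m)).toTopRep.ρ σ (mu K (m * m) δ (D.ε (δ⁻¹ * τ * δ, δ⁻¹ * υ * δ))) -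
            mu K (m * m) δ (D.ε (δ⁻¹ * (σ * τ) * δ, δ⁻¹ * υ * δ)) +
            mu K (m * m) δ (D.ε (δ⁻¹ * σ * δ, δ⁻¹ * (τ * υ) * δ)) -
            mu K (m * m) δ (D.ε (δ⁻¹ * σ * δ, δ⁻¹ * τ * δ))
        rw [← smul_sub, descendHom_smul W m m e hμ hadd₁ hadd₂ hgal, h]
        change _ = (mu K (m * m)).toTopRep.ρ σ ((mu K (m * m)).toTopRep.ρ δ _) -
          (mu K (m * m)).toTopRep.ρ δ _ + (mu K (m * m)).toTopRep.ρ δ _ - (mu K (m * m)).toTopRep.ρ δ _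
        rw [TopRep_ρ_mul_apply, ← mul_conj δ σ, ← TopRep_ρ_mul_apply]
        change mu K (m * m) δ _ = mu K (m * m) δ _ - mu K (m * m) δ _ + mu K (m * m) δ _ - mu K (m * m) δ _
        rw [← map_sub, ← map_add, ← map_sub]
      κ := fun v => D.κ v + resOne (W.torsionGaloisModule _) (Place.Completion v) (cobdCocycle W _ (D.β₁ δ))
      κ_mem := fun v => by
        rw [locClass_add, locClass_resOne_cobdCocycle, add_zero]
        exact D.κ_mem v
      mulK_κ := fun v σ => by
        change mulK W m m ((D.κ v).1 σ + (resOne _ _ _).1 σ) =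
          mulK W m m (δ • D.β₁ (δ⁻¹ * absGaloisRestrict K (Place.Completion v) σ * δ))
        rw [map_add, D.mulK_κ, D.mulK_β₁, mulK_smul, D.mulK_β₁, smul_oneCocycle_apply_conj, resOne_apply,
          cobdCocycle_apply, map_sub, mulK_smul, D.mulK_β₁] }
  refine ⟨D', rfl, rfl, hβc, fun g => rfl, fun g h => rfl, hβ'c, fun g h => rfl, fun v σ => rfl,
    fun inv v => ?_⟩
  -- the local terms: `locClass₂_cocycle_eq_of_innerShift` with the homotopy cochains `h_δ f`, `h_δ ε`
  unfold GeneralCaseData.localTerm GeneralLocalData.term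
  set r := absGaloisRestrict K (Place.Completion v) with hr
  let γ : C(absoluteGaloisGroup (Place.Completion v), torsionRepAt W (Place.Completion v) (m : ℤ)) :=
    ⟨fun σ => D.f.1 (δ, δ⁻¹ * r σ * δ) - D.f.1 (r σ, δ),
      (D.f.1.continuous.comp (continuous_const.prodMk
        ((continuous_const.mul (map_continuous r)).mul continuous_const))).sub
      (D.f.1.continuous.comp ((map_continuous r).prodMk continuous_const))⟩
  let ξ : C(absoluteGaloisGroup (Place.Completion v), muRepAt (K := K) m (Place.Completion v)) :=
    ⟨fun σ => D.ε (δ, δ⁻¹ * r σ * δ) - D.ε (r σ, δ),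
      (D.ε.continuous.comp (continuous_const.prodMk
        ((continuous_const.mul (map_continuous r)).mul continuous_const))).sub
      (D.ε.continuous.comp ((map_continuous r).prodMk continuous_const))⟩
  rw [locClass₂_cocycle_eq_of_innerShift (L := D.localData v) (L' := D'.localData v)
    (D.β₁ δ) (D.β'.1 δ) γ ξ (fun σ => ?_) (fun σ => rfl) (fun σ => rfl) (fun σ τ => ?_)]
  · -- `β₁`: `δ β₁(δ⁻¹ g δ) = β₁ g + ∂(β₁ δ)(g) + ι (h_δ f)(g)`
    change δ • D.β₁ (δ⁻¹ * r σ * δ) = D.β₁ (r σ) + (r σ • D.β₁ δ - D.β₁ δ) +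
      inclKD W m m (D.f.1 (δ, δ⁻¹ * r σ * δ) - D.f.1 (r σ, δ))
    rw [map_sub, D.inclKD_f, D.inclKD_f, mul_conj]
    abel
  · -- `ε`: the homotopy formula
    change mu K (m * m) δ (D.ε (δ⁻¹ * r σ * δ, δ⁻¹ * r τ * δ)) =
      D.ε (r σ, r τ) +
        (mu K (m * m) (r σ) (D.ε (δ, δ⁻¹ * r τ * δ) - D.ε (r τ, δ)) -
          (D.ε (δ, δ⁻¹ * r (σ * τ) * δ) - D.ε (r (σ * τ), δ)) + (D.ε (δ, δ⁻¹ * r σ * δ) - D.ε (r σ, δ))) +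
        descendHom W m m e hμ hadd₁ hadd₂ (D.f.1 (δ, δ⁻¹ * r σ * δ) - D.f.1 (r σ, δ))
          ((D.β'.1 (r (σ * τ)) + (r (σ * τ) • D.β'.1 δ - D.β'.1 δ)) -
            (D.β'.1 (r σ) + (r σ • D.β'.1 δ - D.β'.1 δ))) +
        descendHom W m m e hμ hadd₁ hadd₂ (D.f.1 (r σ, r τ)) (r (σ * τ) • D.β'.1 δ)
    rw [map_mul]
    generalize r σ = σ'
    generalize r τ = τ'
    -- `∂ε = f ∪_desc β'` at the three triples of the homotopy `h_δ`
    have e1 : descendHom W m m e hμ hadd₁ hadd₂ (D.f.1 (δ, δ⁻¹ * σ' * δ))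
        (D.β'.1 (σ' * τ' * δ) - D.β'.1 (σ' * δ)) =
        mu K (m * m) δ (D.ε (δ⁻¹ * σ' * δ, δ⁻¹ * τ' * δ)) - D.ε (σ' * δ, δ⁻¹ * τ' * δ) +
          D.ε (δ, δ⁻¹ * (σ' * τ') * δ) - D.ε (δ, δ⁻¹ * σ' * δ) := by
      have h := D.dTwo_ε δ (δ⁻¹ * σ' * δ) (δ⁻¹ * τ' * δ)
      rw [ContPairing.cupCocycle₂₁_apply, dTwo_apply, descendPairing_toLin_apply, mul_conj, mul_delta_conj,
        conj_mul_conj] at h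
      exact h
    have e2 : descendHom W m m e hμ hadd₁ hadd₂ (D.f.1 (σ', δ)) (D.β'.1 (σ' * τ' * δ) - D.β'.1 (σ' * δ)) =
        mu K (m * m) σ' (D.ε (δ, δ⁻¹ * τ' * δ)) - D.ε (σ' * δ, δ⁻¹ * τ' * δ) + D.ε (σ', τ' * δ) - D.ε (σ', δ) := by
      have h := D.dTwo_ε σ' δ (δ⁻¹ * τ' * δ)
      rw [ContPairing.cupCocycle₂₁_apply, dTwo_apply, descendPairing_toLin_apply, mul_delta_conj, mul_conj] at h
      exact h
    have e3 : descendHom W m m e hμ hadd₁ hadd₂ (D.f.1 (σ', τ')) (D.β'.1 (σ' * τ' * δ) - D.β'.1 (σ' * τ')) =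
        mu K (m * m) σ' (D.ε (τ', δ)) - D.ε (σ' * τ', δ) + D.ε (σ', τ' * δ) - D.ε (σ', τ') := by
      have h := D.dTwo_ε σ' τ' δ
      rw [ContPairing.cupCocycle₂₁_apply, dTwo_apply, descendPairing_toLin_apply] at h
      exact h
    -- `στ β'(δ) = β'(στδ) - β'(στ)`, `σ β'(δ) = β'(σδ) - β'(σ)`
    have hb3 : (σ' * τ') • D.β'.1 δ = D.β'.1 (σ' * τ' * δ) - D.β'.1 (σ' * τ') :=
      (contOneCocycles.apply_mul_sub D.β' (σ' * τ') δ).symm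
    have hb4 : σ' • D.β'.1 δ = D.β'.1 (σ' * δ) - D.β'.1 σ' :=
      (contOneCocycles.apply_mul_sub D.β' σ' δ).symm
    rw [hb3, hb4,
      show D.β'.1 (σ' * τ') + (D.β'.1 (σ' * τ' * δ) - D.β'.1 (σ' * τ') - D.β'.1 δ) -
          (D.β'.1 σ' + (D.β'.1 (σ' * δ) - D.β'.1 σ' - D.β'.1 δ)) =
        D.β'.1 (σ' * τ' * δ) - D.β'.1 (σ' * δ) by abel,
      map_sub (descendHom W m m e hμ hadd₁ hadd₂), AddMonoidHom.sub_apply, e1, e2, e3]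
    simp only [map_sub]
    abel

end Twist

end Summit.BirchSwinnertonDyer.BirchSwinnertonDyer.Theorems.CasselsTateConj

end
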